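import Literature.NumberTheory.Sieve.DrappeauDispersionCompletionInputs
import Literature.NumberTheory.Sieve.DrappeauDispersionAssembly
import Literature.NumberTheory.Sieve.DrappeauDispersionMainTermsBound
import Literature.NumberTheory.Sieve.DrappeauDispersionLemmas
import HarnessLib

/-!
# Drappeau 2017, Proposition 5.3 from the `𝒮₁`-estimate — bookkeeping tools

Topic `Literature/NumberTheory/Sieve`, part of the formalisation of §5 of S. Drappeau, Proc. London
Math. Soc. (3) 114 (2017) 684–732 = arXiv:1504.05549 (Theorem 5.1 = the named fact
`Literature.NumberTheory.Sieve.Drappeau2017_theorem51`).  Everything here is PROVED; no definition and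
no named fact is introduced.

Elementary identities and inequalities used by `DrappeauDispersionProp53` to assemble Proposition 5.3
(in the form of the hypothesis of `Drappeau2017_theorem51_of_smooth_sqfree`) from the dispersion bricks
(`DrappeauDispersionSkeleton`, `…Assembly`, `…S2`, `…S3`, `…CompletionInputs`, `…MainTermsBound`)
and an estimate for `𝒮₁`:

* `Drappeau2017.uR_natFloor` — `𝔲_{⌊R⌋}(t; d) = 𝔲_R(t; d)` (conductors are integers);
* `Drappeau2017.smoothSum_eq_dispSum` — the `γ`-weighted sum of Proposition 5.3 is the dispersion sum
  `𝒟` of `DrappeauDispersionSkeleton` for the moduli `{1 ≤ q ≤ 2S+Y}`, the `m`-range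
  `BFI.mRange M (M/2)` and `α'_m = α_m 1_{m∼M}`;
* `Drappeau2017.sum_mRange_bump_mul_rpow_sq_le`, `Drappeau2017.sum_dyadic_norm_sq_le`,
  `Drappeau2017.sum_filter_dyadic_norm_le` — divisor-power majorants for the weights;
* `Drappeau2017.sum_pairs_S3_weights_le`, `Drappeau2017.sum_pairs_S2_weights_le` — the sums over
  pairs of moduli of the weights produced by `norm_dispS3_sub_mul_mainX3_le'` /
  `norm_dispS2_sub_mul_mainX3_le'` (`#𝒳_q(R) ≤ Rτ(q)`, `1/φ(q) ≤ τ(q)/q`,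
  `∑_{q₁ ≤ Z} (q₁, q₂) ≤ Z τ(q₂)`).

## References

* S. Drappeau, Proc. London Math. Soc. (3) 114 (2017) 684–732, arXiv:1504.05549, §5.3.
  [cite: Drappeau2017, §5.3]
-/

noncomputable section

open Finset Real
open scoped ArithmeticFunction.sigma

namespace Literature.NumberTheory.Sieve

namespace Drappeau2017

/-! ### The kernel at a real cut-off -/

/-- `𝔲_{⌊R⌋}(t; d) = 𝔲_R(t; d)` for `R ≥ 0`: the condition `cond χ > R` only sees `⌊R⌋`. [folklore] -/
theorem uR_natFloor {Rd : ℝ} (hRd : 0 ≤ Rd) (d : ℕ) (t : ZMod d) :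
    uR (⌊Rd⌋₊ : ℝ) d t = uR Rd d t := by
  unfold uR
  congr 1
  refine Finset.sum_congr rfl fun χ _ => ?_
  have h : ((⌊Rd⌋₊ : ℝ) < (χ.conductor : ℝ)) ↔ (Rd < (χ.conductor : ℝ)) := by
    rw [Nat.cast_lt, Nat.floor_lt hRd]
  simp only [h]

/-! ### The smoothed sum is a dispersion sum -/

/-- **The `γ`-weighted sum of Proposition 5.3 as the dispersion sum `𝒟`** of
`DrappeauDispersionSkeleton`: moduli `𝒬 = {q ∈ mRange S Y : q ≥ 1}` (the term `q = 0` carries the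
weight `γ(0) = 0`), `m`-range `mRange M (M/2) ⊇ {m ∼ M}` with `α'_m = α_m 1_{m ∼ M}`, and the cut-off
`⌊Rd⌋`. [cite: Drappeau2017, §5.3 (5.9)] -/
theorem smoothSum_eq_dispSum {S Y M : ℝ} (hY : 0 < Y) (hYS : Y ≤ S) (hM : 0 < M) {Rd : ℝ}
    (hRd : 0 ≤ Rd) (N : ℝ) (a₁ a₂ : ℤ) (α β : ℕ → ℂ) :
    ∑ s ∈ (BFI.mRange S Y).filter (fun s : ℕ => IsCoprime (s : ℤ) (a₁ * a₂)),
        ((BFI.bump S Y s : ℝ) : ℂ) *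
          ∑ m ∈ BFI.dyadic M, ∑ n ∈ (BFI.dyadic N).filter (fun n : ℕ => IsCoprime (n : ℤ) a₂),
            α m * β n * uR Rd s (((m * n : ℕ) : ZMod s) * ((a₁ : ZMod s))⁻¹ * ((a₂ : ZMod s))) =
      dispSum (⌊Rd⌋₊ : ℝ) a₁ a₂ ((BFI.mRange S Y).filter (fun q : ℕ => 0 < q))
        (BFI.mRange M (M / 2)) (BFI.dyadic N) (fun q : ℕ => BFI.bump S Y q)
        (fun m : ℕ => if m ∈ BFI.dyadic M then α m else 0) β := by
  have hS : 0 ≤ S := hY.le.trans hYS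
  rw [dispSum_eq_sum_moduli]
  -- the moduli: `q = 0` carries `γ(0) = 0`
  have hfilt : ((BFI.mRange S Y).filter (fun q : ℕ => 0 < q)).filter
      (fun q : ℕ => IsCoprime (q : ℤ) (a₁ * a₂)) =
      ((BFI.mRange S Y).filter (fun q : ℕ => IsCoprime (q : ℤ) (a₁ * a₂))).filter
        (fun q : ℕ => 0 < q) := by
    rw [Finset.filter_filter, Finset.filter_filter]
    exact Finset.filter_congr fun q _ => and_comm
  rw [hfilt]
  symm
  rw [Finset.sum_filter_of_ne]
  swap
  · intro q _ hq
    rcases Nat.eq_zero_or_pos q with hq0 | hpos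
    · exfalso
      apply hq
      subst hq0
      rw [Nat.cast_zero, BFI.bump_eq_zero_of_le hY hS (by linarith), Complex.ofReal_zero, zero_mul]
    · exact hpos
  refine Finset.sum_congr rfl fun q _ => ?_
  congr 1
  -- the `m`-range
  have hsub : BFI.dyadic M ⊆ BFI.mRange M (M / 2) := BFI.dyadic_subset_mRange (by linarith)
  rw [← Finset.sum_subset hsub]
  · refine Finset.sum_congr rfl fun m hm => Finset.sum_congr rfl fun n _ => ?_
    rw [if_pos hm, uR_natFloor hRd]
    rfl
  · intro m _ hm
    refine Finset.sum_eq_zero fun n _ => ?_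
    rw [if_neg hm, zero_mul, zero_mul]

/-! ### Divisor-power majorants -/

/-- `∑_{m ∈ mRange M (M/2)} α(m) (τ(m)^A)² ≤ ∑_{1 ≤ m ≤ 2M+M/2} τ(m)^r` for `2A ≤ r` (`α ≤ 1`,
`α(0) = 0`). [folklore] -/
theorem sum_mRange_bump_mul_rpow_sq_le {M : ℝ} (hM : 0 < M) {A : ℝ} {r : ℕ}
    (hr : 2 * A ≤ r) :
    ∑ m ∈ BFI.mRange M (M / 2), BFI.bump M (M / 2) m * ((σ 0 m : ℝ) ^ A) ^ 2 ≤
      ∑ m ∈ Icc 1 ⌊2 * M + M / 2⌋₊, (σ 0 m : ℝ) ^ r := by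
  have hM2 : (0 : ℝ) < M / 2 := by linarith
  have hsplit : BFI.mRange M (M / 2) = insert 0 (Icc 1 ⌊2 * M + M / 2⌋₊) := by
    ext m
    rw [BFI.mem_mRange, Finset.mem_insert, Finset.mem_Icc]
    omega
  rw [hsplit, Finset.sum_insert (by simp)]
  have h0 : BFI.bump M (M / 2) ((0 : ℕ) : ℝ) * ((σ 0 (0 : ℕ) : ℝ) ^ A) ^ 2 = 0 := by
    rw [Nat.cast_zero, BFI.bump_eq_zero_of_le hM2 hM.le (by linarith), zero_mul]
  rw [h0, zero_add]
  refine Finset.sum_le_sum fun m hm => ?_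
  have hm1 : 1 ≤ m := (Finset.mem_Icc.1 hm).1
  have hτ : (1 : ℝ) ≤ (σ 0 m : ℝ) := by exact_mod_cast one_le_sigma_zero (by omega)
  have hb := BFI.bump_mem_Icc hM2 hM.le (m : ℝ)
  calc BFI.bump M (M / 2) m * ((σ 0 m : ℝ) ^ A) ^ 2 ≤ 1 * ((σ 0 m : ℝ) ^ A) ^ 2 :=
        mul_le_mul_of_nonneg_right hb.2 (by positivity)
    _ = (σ 0 m : ℝ) ^ (2 * A) := by
        rw [one_mul, ← Real.rpow_natCast, ← Real.rpow_mul (by positivity)]; ring_nf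
    _ ≤ (σ 0 m : ℝ) ^ (r : ℝ) := Real.rpow_le_rpow_of_exponent_le hτ hr
    _ = (σ 0 m : ℝ) ^ r := Real.rpow_natCast _ _

/-- `∑_{n ∼ N} ‖β_n‖² ≤ ∑_{1 ≤ n ≤ 2N} τ(n)^r` when `‖β_n‖ ≤ τ(n)^A`, `2A ≤ r`. [folklore] -/
theorem sum_dyadic_norm_sq_le {N : ℝ} (hN : 0 < N) {A : ℝ} {r : ℕ} (hr : 2 * A ≤ r)
    {β : ℕ → ℂ} (hβ : ∀ n, ‖β n‖ ≤ (σ 0 n : ℝ) ^ A) :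
    ∑ n ∈ BFI.dyadic N, ‖β n‖ ^ 2 ≤ ∑ n ∈ Icc 1 ⌊2 * N⌋₊, (σ 0 n : ℝ) ^ r := by
  have hsub : BFI.dyadic N ⊆ Icc 1 ⌊2 * N⌋₊ := by
    intro n hn
    have h := (BFI.mem_dyadic hN.le).1 hn
    rw [Finset.mem_Icc]
    refine ⟨?_, Nat.le_floor h.2⟩
    have : (0 : ℝ) < n := hN.trans h.1
    exact_mod_cast this
  refine (Finset.sum_le_sum_of_subset_of_nonneg hsub fun _ _ _ => by positivity).trans
    (Finset.sum_le_sum fun n hn => ?_)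
  have hn1 : 1 ≤ n := (Finset.mem_Icc.1 hn).1
  have hτ : (1 : ℝ) ≤ (σ 0 n : ℝ) := by exact_mod_cast one_le_sigma_zero (by omega)
  calc ‖β n‖ ^ 2 ≤ ((σ 0 n : ℝ) ^ A) ^ 2 := pow_le_pow_left₀ (norm_nonneg _) (hβ n) 2
    _ = (σ 0 n : ℝ) ^ (2 * A) := by
        rw [← Real.rpow_natCast, ← Real.rpow_mul (by positivity)]; ring_nf
    _ ≤ (σ 0 n : ℝ) ^ (r : ℝ) := Real.rpow_le_rpow_of_exponent_le hτ hr
    _ = (σ 0 n : ℝ) ^ r := Real.rpow_natCast _ _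

/-- `∑_{n ∼ N, P n} ‖β_n‖ ≤ ∑_{1 ≤ n ≤ 2N} τ(n)^r` when `‖β_n‖ ≤ τ(n)^A`, `A ≤ r`. [folklore] -/
theorem sum_filter_dyadic_norm_le {N : ℝ} (hN : 0 < N) {A : ℝ} {r : ℕ} (hr : A ≤ r)
    {β : ℕ → ℂ} (hβ : ∀ n, ‖β n‖ ≤ (σ 0 n : ℝ) ^ A) (P : ℕ → Prop) [DecidablePred P] :
    ∑ n ∈ (BFI.dyadic N).filter P, ‖β n‖ ≤ ∑ n ∈ Icc 1 ⌊2 * N⌋₊, (σ 0 n : ℝ) ^ r := by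
  have hsub : (BFI.dyadic N).filter P ⊆ Icc 1 ⌊2 * N⌋₊ := by
    intro n hn
    have h := (BFI.mem_dyadic hN.le).1 (Finset.mem_filter.1 hn).1
    rw [Finset.mem_Icc]
    refine ⟨?_, Nat.le_floor h.2⟩
    have : (0 : ℝ) < n := hN.trans h.1
    exact_mod_cast this
  refine (Finset.sum_le_sum_of_subset_of_nonneg hsub fun _ _ _ => norm_nonneg _).trans
    (Finset.sum_le_sum fun n hn => ?_)
  have hn1 : 1 ≤ n := (Finset.mem_Icc.1 hn).1
  have hτ : (1 : ℝ) ≤ (σ 0 n : ℝ) := by exact_mod_cast one_le_sigma_zero (by omega)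
  calc ‖β n‖ ≤ (σ 0 n : ℝ) ^ A := hβ n
    _ ≤ (σ 0 n : ℝ) ^ (r : ℝ) := Real.rpow_le_rpow_of_exponent_le hτ hr
    _ = (σ 0 n : ℝ) ^ r := Real.rpow_natCast _ _

/-! ### The weights of the pairs of moduli -/

/-- `#𝒳_q(R) ≤ R τ(q)` (`DrappeauTopacogullari2019.card_filter_conductor_le`). [folklore] -/
theorem card_charFilter_le {q : ℕ} (hq : 0 < q) {R : ℝ} (hR : 0 ≤ R) :
    (((univ.filter fun χ : DirichletCharacter ℂ q => (χ.conductor : ℝ) ≤ R).card : ℝ)) ≤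
      R * (σ 0 q : ℝ) := by
  have h := DrappeauTopacogullari2019.card_filter_conductor_le hq hR
  rwa [← ArithmeticFunction.sigma_zero_apply] at h

/-- `φ(q)⁻¹ #𝒳_q(R) ≤ R τ(q)²/q`. [folklore] -/
theorem inv_totient_mul_card_le {q : ℕ} (hq : 0 < q) {R : ℝ} (hR : 0 ≤ R) :
    ((Nat.totient q : ℝ))⁻¹ *
        (((univ.filter fun χ : DirichletCharacter ℂ q => (χ.conductor : ℝ) ≤ R).card : ℝ)) ≤
      R * (σ 0 q : ℝ) ^ 2 / q := by
  have h1 := inv_totient_le_sigma_zero_div q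
  have h2 := card_charFilter_le hq hR
  have hφ : (0 : ℝ) ≤ ((Nat.totient q : ℝ))⁻¹ := by positivity
  calc ((Nat.totient q : ℝ))⁻¹ *
        (((univ.filter fun χ : DirichletCharacter ℂ q => (χ.conductor : ℝ) ≤ R).card : ℝ))
      ≤ ((σ 0 q : ℝ) / q) * (R * (σ 0 q : ℝ)) := mul_le_mul h1 h2 (by positivity) (by positivity)
    _ = R * (σ 0 q : ℝ) ^ 2 / q := by ring

/-- `τ([q₁,q₂]) ≤ τ(q₁) τ(q₂)` (`[q₁,q₂] ∣ q₁q₂`). [folklore] -/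
theorem sigma_zero_lcm_le {q₁ q₂ : ℕ} (hq₁ : 0 < q₁) (hq₂ : 0 < q₂) :
    (σ 0 (Nat.lcm q₁ q₂) : ℝ) ≤ (σ 0 q₁ : ℝ) * (σ 0 q₂ : ℝ) := by
  have h1 : σ 0 (Nat.lcm q₁ q₂) ≤ σ 0 (q₁ * q₂) :=
    sigma_zero_le_of_dvd (Nat.mul_ne_zero hq₁.ne' hq₂.ne') (Nat.lcm_dvd_mul q₁ q₂)
  have h2 := sigma_zero_mul_le q₁ q₂
  exact_mod_cast h1.trans h2

/-- `τ(q₂/(q₁,q₂)) ≤ τ(q₂)`. [folklore] -/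
theorem sigma_zero_div_gcd_le {q₁ q₂ : ℕ} (hq₂ : 0 < q₂) :
    (σ 0 (q₂ / Nat.gcd q₁ q₂) : ℝ) ≤ (σ 0 q₂ : ℝ) := by
  exact_mod_cast sigma_zero_le_of_dvd hq₂.ne' (Nat.div_dvd_of_dvd (Nat.gcd_dvd_right q₁ q₂))

/-- **Summing the `𝒮₃` weights over the pairs of moduli**: if `𝒬 ⊆ [1, L₀]`, `|γ| ≤ 1`, `R ≥ 0`
and `0 ≤ E(q₁,q₂) ≤ E₀ τ(q₁) τ(q₂)`, then
`∑_{q₁,q₂ ∈ 𝒬'} |γ(q₁)γ(q₂)| (φ(q₁)φ(q₂))⁻¹ #𝒳_{q₁}(R) #𝒳_{q₂}(R) B² E(q₁,q₂) ≤ R² B² E₀ (∑_{q ≤ L₀} τ(q)³/q)²`.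
[cite: Drappeau2017, §5.3 (5.16)] -/
theorem sum_pairs_S3_weights_le {𝒬 : Finset ℕ} {L₀ : ℕ} (h𝒬 : 𝒬 ⊆ Icc 1 L₀) (P : ℕ → Prop)
    [DecidablePred P] {γ : ℕ → ℝ} (hγ : ∀ q, |γ q| ≤ 1) {R B E₀ : ℝ} (hR : 0 ≤ R)
    (hE₀ : 0 ≤ E₀) {E : ℕ → ℕ → ℝ} (hE0 : ∀ q₁ q₂, 0 ≤ E q₁ q₂)
    (hE : ∀ q₁ ∈ 𝒬, ∀ q₂ ∈ 𝒬, E q₁ q₂ ≤ E₀ * (σ 0 q₁ : ℝ) * (σ 0 q₂ : ℝ)) :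
    ∑ q₁ ∈ 𝒬.filter P, ∑ q₂ ∈ 𝒬.filter P, |γ q₁ * γ q₂| *
        ((((Nat.totient q₁ : ℝ)) * (Nat.totient q₂ : ℝ))⁻¹ *
          (((univ.filter fun χ : DirichletCharacter ℂ q₁ => (χ.conductor : ℝ) ≤ R).card : ℝ) *
            ((univ.filter fun χ : DirichletCharacter ℂ q₂ => (χ.conductor : ℝ) ≤ R).card : ℝ) *
            B ^ 2 * E q₁ q₂)) ≤
      R ^ 2 * B ^ 2 * E₀ * (∑ q ∈ Icc 1 L₀, (σ 0 q : ℝ) ^ 3 / q) ^ 2 := by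
  have hsub : 𝒬.filter P ⊆ Icc 1 L₀ := (Finset.filter_subset _ _).trans h𝒬
  -- termwise
  have hterm : ∀ q₁ ∈ 𝒬.filter P, ∀ q₂ ∈ 𝒬.filter P, |γ q₁ * γ q₂| *
      ((((Nat.totient q₁ : ℝ)) * (Nat.totient q₂ : ℝ))⁻¹ *
        (((univ.filter fun χ : DirichletCharacter ℂ q₁ => (χ.conductor : ℝ) ≤ R).card : ℝ) *
          ((univ.filter fun χ : DirichletCharacter ℂ q₂ => (χ.conductor : ℝ) ≤ R).card : ℝ) *
          B ^ 2 * E q₁ q₂)) ≤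
      R ^ 2 * B ^ 2 * E₀ * (((σ 0 q₁ : ℝ) ^ 3 / q₁) * ((σ 0 q₂ : ℝ) ^ 3 / q₂)) := by
    intro q₁ hq₁ q₂ hq₂
    have hq₁' := Finset.mem_Icc.1 (hsub hq₁)
    have hq₂' := Finset.mem_Icc.1 (hsub hq₂)
    have hq₁0 : 0 < q₁ := hq₁'.1
    have hq₂0 : 0 < q₂ := hq₂'.1
    have hq₁m := (Finset.mem_filter.1 hq₁).1
    have hq₂m := (Finset.mem_filter.1 hq₂).1
    have hγ1 : |γ q₁ * γ q₂| ≤ 1 := by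
      rw [abs_mul]; exact mul_le_one₀ (hγ q₁) (abs_nonneg _) (hγ q₂)
    set X₁ : ℝ := (((univ.filter fun χ : DirichletCharacter ℂ q₁ => (χ.conductor : ℝ) ≤ R).card : ℝ))
      with hX₁
    set X₂ : ℝ := (((univ.filter fun χ : DirichletCharacter ℂ q₂ => (χ.conductor : ℝ) ≤ R).card : ℝ))
      with hX₂
    have h1 : ((Nat.totient q₁ : ℝ))⁻¹ * X₁ ≤ R * (σ 0 q₁ : ℝ) ^ 2 / q₁ :=
      inv_totient_mul_card_le hq₁0 hR
    have h2 : ((Nat.totient q₂ : ℝ))⁻¹ * X₂ ≤ R * (σ 0 q₂ : ℝ) ^ 2 / q₂ :=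
      inv_totient_mul_card_le hq₂0 hR
    have hw : (((Nat.totient q₁ : ℝ)) * (Nat.totient q₂ : ℝ))⁻¹ * (X₁ * X₂) ≤
        (R * (σ 0 q₁ : ℝ) ^ 2 / q₁) * (R * (σ 0 q₂ : ℝ) ^ 2 / q₂) := by
      calc (((Nat.totient q₁ : ℝ)) * (Nat.totient q₂ : ℝ))⁻¹ * (X₁ * X₂)
          = (((Nat.totient q₁ : ℝ))⁻¹ * X₁) * (((Nat.totient q₂ : ℝ))⁻¹ * X₂) := by
            rw [mul_inv]; ring
        _ ≤ _ := mul_le_mul h1 h2 (by positivity) (by positivity)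
    have hEq := hE q₁ hq₁m q₂ hq₂m
    have hX₁0 : 0 ≤ X₁ := Nat.cast_nonneg _
    have hX₂0 : 0 ≤ X₂ := Nat.cast_nonneg _
    have hE00 := hE0 q₁ q₂
    calc |γ q₁ * γ q₂| * ((((Nat.totient q₁ : ℝ)) * (Nat.totient q₂ : ℝ))⁻¹ * (X₁ * X₂ * B ^ 2 * E q₁ q₂))
        = |γ q₁ * γ q₂| * (((((Nat.totient q₁ : ℝ)) * (Nat.totient q₂ : ℝ))⁻¹ * (X₁ * X₂)) *
            B ^ 2 * E q₁ q₂) := by ring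
      _ ≤ 1 * (((R * (σ 0 q₁ : ℝ) ^ 2 / q₁) * (R * (σ 0 q₂ : ℝ) ^ 2 / q₂)) * B ^ 2 *
          (E₀ * (σ 0 q₁ : ℝ) * (σ 0 q₂ : ℝ))) := by
          refine mul_le_mul hγ1 ?_ (by positivity) zero_le_one
          exact mul_le_mul (mul_le_mul_of_nonneg_right hw (by positivity)) hEq (hE0 _ _)
            (by positivity)
      _ = _ := by ring
  calc _ ≤ ∑ q₁ ∈ 𝒬.filter P, ∑ q₂ ∈ 𝒬.filter P,
        R ^ 2 * B ^ 2 * E₀ * (((σ 0 q₁ : ℝ) ^ 3 / q₁) * ((σ 0 q₂ : ℝ) ^ 3 / q₂)) :=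
        Finset.sum_le_sum fun q₁ hq₁ => Finset.sum_le_sum fun q₂ hq₂ => hterm q₁ hq₁ q₂ hq₂
    _ = R ^ 2 * B ^ 2 * E₀ * ((∑ q₁ ∈ 𝒬.filter P, (σ 0 q₁ : ℝ) ^ 3 / q₁) *
          ∑ q₂ ∈ 𝒬.filter P, (σ 0 q₂ : ℝ) ^ 3 / q₂) := by
        rw [Finset.sum_mul_sum, Finset.mul_sum]
        refine Finset.sum_congr rfl fun q₁ _ => ?_
        rw [Finset.mul_sum]
    _ ≤ R ^ 2 * B ^ 2 * E₀ * ((∑ q ∈ Icc 1 L₀, (σ 0 q : ℝ) ^ 3 / q) *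
          ∑ q ∈ Icc 1 L₀, (σ 0 q : ℝ) ^ 3 / q) := by
        have hs : ∑ q ∈ 𝒬.filter P, (σ 0 q : ℝ) ^ 3 / q ≤ ∑ q ∈ Icc 1 L₀, (σ 0 q : ℝ) ^ 3 / q :=
          Finset.sum_le_sum_of_subset_of_nonneg hsub fun _ _ _ => by positivity
        have h0 : 0 ≤ ∑ q ∈ 𝒬.filter P, (σ 0 q : ℝ) ^ 3 / q :=
          Finset.sum_nonneg fun _ _ => by positivity
        exact mul_le_mul_of_nonneg_left (mul_le_mul hs hs h0 (h0.trans hs)) (by positivity)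
    _ = _ := by ring

/-- **Summing the `𝒮₂` weights over the pairs of moduli**: if `𝒬 ⊆ [1, L₀]`, `|γ| ≤ 1`, `R ≥ 0`
and `0 ≤ E(q₁,q₂) ≤ E₁ τ(q₂) (q₁,q₂) + E₂` (`E₁, E₂ ≥ 0`), then
`∑_{q₁,q₂ ∈ 𝒬'} |γ(q₁)γ(q₂)| φ(q₂)⁻¹ #𝒳_{q₂}(R) B² E(q₁,q₂) ≤ R B² L₀ (E₁ + E₂) ∑_{q ≤ L₀} τ(q)⁴/q`
(`∑_{q₁ ≤ L₀} (q₁, q₂) ≤ L₀ τ(q₂)`). [cite: Drappeau2017, §5.3 (5.19)] -/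
theorem sum_pairs_S2_weights_le {𝒬 : Finset ℕ} {L₀ : ℕ} (h𝒬 : 𝒬 ⊆ Icc 1 L₀) (P : ℕ → Prop)
    [DecidablePred P] {γ : ℕ → ℝ} (hγ : ∀ q, |γ q| ≤ 1) {R B E₁ E₂ : ℝ} (hR : 0 ≤ R)
    (hE₁ : 0 ≤ E₁) (hE₂ : 0 ≤ E₂) {E : ℕ → ℕ → ℝ} (hE0 : ∀ q₁ q₂, 0 ≤ E q₁ q₂)
    (hE : ∀ q₁ ∈ 𝒬, ∀ q₂ ∈ 𝒬, E q₁ q₂ ≤ E₁ * (σ 0 q₂ : ℝ) * (Nat.gcd q₁ q₂ : ℝ) + E₂) :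
    ∑ q₁ ∈ 𝒬.filter P, ∑ q₂ ∈ 𝒬.filter P, |γ q₁ * γ q₂| *
        (((Nat.totient q₂ : ℝ))⁻¹ *
          (((univ.filter fun χ : DirichletCharacter ℂ q₂ => (χ.conductor : ℝ) ≤ R).card : ℝ) *
            B ^ 2 * E q₁ q₂)) ≤
      R * B ^ 2 * L₀ * (E₁ + E₂) * ∑ q ∈ Icc 1 L₀, (σ 0 q : ℝ) ^ 4 / q := by
  have hsub : 𝒬.filter P ⊆ Icc 1 L₀ := (Finset.filter_subset _ _).trans h𝒬
  -- termwise, then sum over `q₁` first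
  have hterm : ∀ q₁ ∈ 𝒬.filter P, ∀ q₂ ∈ 𝒬.filter P, |γ q₁ * γ q₂| *
      (((Nat.totient q₂ : ℝ))⁻¹ *
        (((univ.filter fun χ : DirichletCharacter ℂ q₂ => (χ.conductor : ℝ) ≤ R).card : ℝ) *
          B ^ 2 * E q₁ q₂)) ≤
      R * B ^ 2 * ((σ 0 q₂ : ℝ) ^ 2 / q₂) * (E₁ * (σ 0 q₂ : ℝ) * (Nat.gcd q₁ q₂ : ℝ) + E₂) := by
    intro q₁ hq₁ q₂ hq₂
    have hq₂' := Finset.mem_Icc.1 (hsub hq₂)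
    have hq₂0 : 0 < q₂ := hq₂'.1
    have hq₁m := (Finset.mem_filter.1 hq₁).1
    have hq₂m := (Finset.mem_filter.1 hq₂).1
    have hγ1 : |γ q₁ * γ q₂| ≤ 1 := by
      rw [abs_mul]; exact mul_le_one₀ (hγ q₁) (abs_nonneg _) (hγ q₂)
    set X₂ : ℝ := (((univ.filter fun χ : DirichletCharacter ℂ q₂ => (χ.conductor : ℝ) ≤ R).card : ℝ))
      with hX₂
    have hw : ((Nat.totient q₂ : ℝ))⁻¹ * X₂ ≤ R * (σ 0 q₂ : ℝ) ^ 2 / q₂ :=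
      inv_totient_mul_card_le hq₂0 hR
    have hEq := hE q₁ hq₁m q₂ hq₂m
    have hX₂0 : 0 ≤ X₂ := Nat.cast_nonneg _
    have hE00 := hE0 q₁ q₂
    calc |γ q₁ * γ q₂| * (((Nat.totient q₂ : ℝ))⁻¹ * (X₂ * B ^ 2 * E q₁ q₂))
        = |γ q₁ * γ q₂| * ((((Nat.totient q₂ : ℝ))⁻¹ * X₂) * (B ^ 2 * E q₁ q₂)) := by ring
      _ ≤ 1 * ((R * (σ 0 q₂ : ℝ) ^ 2 / q₂) * (B ^ 2 *
          (E₁ * (σ 0 q₂ : ℝ) * (Nat.gcd q₁ q₂ : ℝ) + E₂))) := by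
          refine mul_le_mul hγ1 ?_ (by positivity) zero_le_one
          exact mul_le_mul hw (mul_le_mul_of_nonneg_left hEq (by positivity)) (by positivity)
            (by positivity)
      _ = _ := by ring
  have hgcd : ∀ q₂ ∈ 𝒬.filter P, ∑ q₁ ∈ 𝒬.filter P, (Nat.gcd q₁ q₂ : ℝ) ≤ L₀ * (σ 0 q₂ : ℝ) := by
    intro q₂ hq₂
    have hq₂0 : 0 < q₂ := (Finset.mem_Icc.1 (hsub hq₂)).1
    calc ∑ q₁ ∈ 𝒬.filter P, (Nat.gcd q₁ q₂ : ℝ) ≤ ∑ q₁ ∈ Icc 1 L₀, (Nat.gcd q₁ q₂ : ℝ) :=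
          Finset.sum_le_sum_of_subset_of_nonneg hsub fun _ _ _ => by positivity
      _ = ∑ q₁ ∈ Icc 1 L₀, (Nat.gcd q₂ q₁ : ℝ) := by
          refine Finset.sum_congr rfl fun q₁ _ => by rw [Nat.gcd_comm]
      _ ≤ L₀ * (σ 0 q₂ : ℝ) := sum_Icc_gcd_le q₂ L₀ hq₂0.ne'
  calc _ ≤ ∑ q₁ ∈ 𝒬.filter P, ∑ q₂ ∈ 𝒬.filter P,
        R * B ^ 2 * ((σ 0 q₂ : ℝ) ^ 2 / q₂) * (E₁ * (σ 0 q₂ : ℝ) * (Nat.gcd q₁ q₂ : ℝ) + E₂) :=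
        Finset.sum_le_sum fun q₁ hq₁ => Finset.sum_le_sum fun q₂ hq₂ => hterm q₁ hq₁ q₂ hq₂
    _ = ∑ q₂ ∈ 𝒬.filter P, R * B ^ 2 * ((σ 0 q₂ : ℝ) ^ 2 / q₂) *
          (E₁ * (σ 0 q₂ : ℝ) * ∑ q₁ ∈ 𝒬.filter P, (Nat.gcd q₁ q₂ : ℝ) +
            (𝒬.filter P).card * E₂) := by
        rw [Finset.sum_comm]
        refine Finset.sum_congr rfl fun q₂ _ => ?_
        rw [← Finset.mul_sum, Finset.sum_add_distrib, Finset.mul_sum, Finset.sum_const, nsmul_eq_mul]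
    _ ≤ ∑ q₂ ∈ 𝒬.filter P, R * B ^ 2 * ((σ 0 q₂ : ℝ) ^ 2 / q₂) *
          (E₁ * (σ 0 q₂ : ℝ) * (L₀ * (σ 0 q₂ : ℝ)) + L₀ * E₂) := by
        refine Finset.sum_le_sum fun q₂ hq₂ => mul_le_mul_of_nonneg_left ?_ (by positivity)
        refine add_le_add (mul_le_mul_of_nonneg_left (hgcd q₂ hq₂) (by positivity)) ?_
        refine mul_le_mul_of_nonneg_right ?_ hE₂
        calc ((𝒬.filter P).card : ℝ) ≤ (Icc 1 L₀).card := by exact_mod_cast Finset.card_le_card hsub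
          _ = L₀ := by simp
    _ ≤ ∑ q₂ ∈ 𝒬.filter P, R * B ^ 2 * L₀ * (E₁ + E₂) * ((σ 0 q₂ : ℝ) ^ 4 / q₂) := by
        refine Finset.sum_le_sum fun q₂ hq₂ => ?_
        have hq₂0 : 0 < q₂ := (Finset.mem_Icc.1 (hsub hq₂)).1
        have hτ : (1 : ℝ) ≤ (σ 0 q₂ : ℝ) := by exact_mod_cast one_le_sigma_zero hq₂0.ne'
        have hq : (0 : ℝ) < q₂ := by exact_mod_cast hq₂0
        have hτ2 : (σ 0 q₂ : ℝ) ^ 2 ≤ (σ 0 q₂ : ℝ) ^ 4 := pow_le_pow_right₀ hτ (by norm_num)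
        have hkey : E₁ * (σ 0 q₂ : ℝ) ^ 4 + E₂ * (σ 0 q₂ : ℝ) ^ 2 ≤
            (E₁ + E₂) * (σ 0 q₂ : ℝ) ^ 4 := by
          have := mul_le_mul_of_nonneg_left hτ2 hE₂
          linarith
        have hc : 0 ≤ R * B ^ 2 * L₀ / (q₂ : ℝ) := by positivity
        calc R * B ^ 2 * ((σ 0 q₂ : ℝ) ^ 2 / q₂) *
              (E₁ * (σ 0 q₂ : ℝ) * (L₀ * (σ 0 q₂ : ℝ)) + L₀ * E₂)
            = (R * B ^ 2 * L₀ / (q₂ : ℝ)) * (E₁ * (σ 0 q₂ : ℝ) ^ 4 + E₂ * (σ 0 q₂ : ℝ) ^ 2) := by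
              field_simp
          _ ≤ (R * B ^ 2 * L₀ / (q₂ : ℝ)) * ((E₁ + E₂) * (σ 0 q₂ : ℝ) ^ 4) :=
              mul_le_mul_of_nonneg_left hkey hc
          _ = R * B ^ 2 * L₀ * (E₁ + E₂) * ((σ 0 q₂ : ℝ) ^ 4 / q₂) := by
              field_simp
    _ = R * B ^ 2 * L₀ * (E₁ + E₂) * ∑ q₂ ∈ 𝒬.filter P, (σ 0 q₂ : ℝ) ^ 4 / q₂ := by
        rw [← Finset.mul_sum]
    _ ≤ _ := by
        refine mul_le_mul_of_nonneg_left ?_ (by positivity)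
        exact Finset.sum_le_sum_of_subset_of_nonneg hsub fun _ _ _ => by positivity

end Drappeau2017

end Literature.NumberTheory.Sieve

end
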